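import Mathlib.RingTheory.AdicCompletion.LocalRing
import Mathlib.RingTheory.AdicCompletion.AsTensorProduct
import Mathlib.RingTheory.Flat.FaithfullyFlat.Basic
import Mathlib.RingTheory.Flat.TorsionFree
import Mathlib.RingTheory.Flat.FaithfullyFlat.Algebra
import Mathlib.RingTheory.Ideal.MinimalPrime.Noetherian
import Mathlib.RingTheory.IntegralClosure.IsIntegralClosure.Basic
import Mathlib.RingTheory.Localization.FractionRing
import Mathlib.RingTheory.Localization.BaseChange
import Mathlib.RingTheory.Ideal.MinimalPrime.Localization
import Mathlib.RingTheory.Nilpotent.Lemmas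
import Mathlib.RingTheory.Finiteness.Prod
import Literature.AlgebraicGeometry.Resolution.AdicNoetherian
import HarnessLib

/-!
# Descent of finiteness of the normalization from the completion (Stacks 10.162.10 (4)–(5), the descent step)

Topic: `Literature/AlgebraicGeometry/Resolution`. A step of EGA IV₂ (7.6.4)/(7.7.2) (Zariski–Nagata,
Nagata) in the arrangement of the Stacks Project, Lemma 10.162.10 (Tag 032Y) (4)–(5): *"Assume `R` is
analytically unramified … Denote `R'` the integral closure of `R` in `Q(R)`. As `R → R^∧` is flat we
see that `R' ⊗_R R^∧ ⊂ Q(R) ⊗_R R^∧ ⊂ Q(R^∧)`. Moreover `R' ⊗_R R^∧` is integral over `R^∧`. Hence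
`R' ⊗_R R^∧ ⊂ S` is a `R^∧`-submodule. As `R^∧` is Noetherian it is a finite `R^∧`-module. … By
faithful flatness we see that `R'` is generated by `f_1, …, f_n` as an `R`-module."* Here `S` is the
integral closure of `R^∧` in its total ring of fractions, *"equal to `S_1 × … × S_s` with `S_i` the
integral closure of `R^∧/𝔭_i` in its fraction field"*, `𝔭_1, …, 𝔭_s` the minimal primes of the
reduced ring `R^∧`.

We PROVE this descent step for a Noetherian local DOMAIN `A` (Stacks' part (5), "N-1"), in a form that
ISOLATES the remaining input — the finiteness of the normalizations `S_i` of the complete local domains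
`Â/𝔮_i` (Stacks 10.162.8, Nagata: complete local rings are Nagata rings) — as a hypothesis on the
minimal primes of `Â`:

* `module_finite_of_faithfullyFlat_of_injective` — the abstract descent: for `A → B` faithfully flat
  with `B` Noetherian, an `A`-submodule `M ⊆ K` and an injective `B`-linear map `B ⊗_A M → P` with
  range inside a finitely generated `B`-submodule, `M` is a finite `A`-module
  (Mathlib's `Submodule.IsNoetherian.of_isNoetherian_tensorProduct_of_faithfullyFlat`);
* `algebraMap_adicCompletion_mem_nonZeroDivisors`, `algebraMap_adicCompletion_notMem_of_mem_minimalPrimes`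
  — non-zero elements of `A` are non-zero-divisors of the flat `A`-algebra `Â`, hence lie in no
  minimal prime of `Â`;
* `module_finite_integralClosure_of_isReduced_adicCompletion_of_minimalPrimes` — **if `Â` is reduced and the integral
  closure of `Â/𝔮` in `Frac(Â/𝔮)` is finite over `Â/𝔮` for every minimal prime `𝔮` of `Â`, then the
  integral closure of `A` in `Frac A` is a finite `A`-module.** The map
  `Â ⊗_A Frac A → ∏_𝔮 Frac(Â/𝔮)` is injective because `Â ⊗_A Frac A` is the localisation of `Â` at
  `A ∖ 0` and `⋂ 𝔮 = nil(Â) = 0`; no total ring of fractions is needed.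

Everything here is proved; no definitions, no named facts. (The one-dimensional case, where the
input on `Â/𝔮` is automatic, is `OneDimAnalyticallyUnramifiedFinite.module_finite_integralClosure_of_isReduced_adicCompletion`,
Kollár Thm. 1.101; the present file is the dimension-free descent.) Used by the discharge of
`EGAIV2_7_7_4_finiteNormalization_completeLocal` (`FiniteNormalizationCompleteLocalBase.lean`).

## References

* [StacksProject] The Stacks Project, Tag 032Y (Lemma 10.162.10 (4), (5)) and Tag 032W (Lemma 10.162.8).
* [EGAIV2] A. Grothendieck, J. Dieudonné, EGA IV₂, Publ. Math. IHÉS 24 (1965), (7.6.1)–(7.6.4), p. 209–211.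
-/

noncomputable section

open IsLocalRing TensorProduct

namespace Literature.AlgebraicGeometry.Resolution

universe u

/-! ## The abstract faithfully flat descent of finiteness -/

/-- **Faithfully flat descent of finite generation through an injective comparison map.** Let
`A → B` be faithfully flat with `B` Noetherian, `M ⊆ K` an `A`-submodule, and `Ψ : B ⊗_A M → P` an
injective `B`-linear map whose range lies in a finitely generated `B`-submodule `C ⊆ P`. Then `M` is a
finite `A`-module: `B ⊗_A M` is a Noetherian `B`-module, and Noetherianity descends along faithfully
flat maps (Stacks 10.162.10, end of the proof of (4): "By faithful flatness we see that `R'` is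
generated by `f_1, …, f_n` as an `R`-module"). [cite: StacksProject, Tag 032Y (proof of (4))] -/
theorem module_finite_of_faithfullyFlat_of_injective
    {R : Type*} [CommRing R] {B : Type*} [CommRing B] [Algebra R B] [Module.FaithfullyFlat R B]
    [IsNoetherianRing B] {K : Type*} [AddCommGroup K] [Module R K] (M : Submodule R K)
    {P : Type*} [AddCommGroup P] [Module B P]
    (Ψ : B ⊗[R] M →ₗ[B] P) (hΨ : Function.Injective Ψ) (C : Submodule B P) (hC : C.FG)
    (hle : LinearMap.range Ψ ≤ C) : Module.Finite R M := by
  haveI : IsNoetherian B C := isNoetherian_of_fg_of_noetherian C hC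
  let Ψ' : B ⊗[R] M →ₗ[B] C := LinearMap.codRestrict C Ψ fun x => hle (LinearMap.mem_range_self Ψ x)
  have hΨ' : Function.Injective Ψ' := fun x y h => hΨ (by simpa [Ψ'] using congrArg Subtype.val h)
  haveI : IsNoetherian B (B ⊗[R] M) := isNoetherian_of_injective Ψ' hΨ'
  haveI : IsNoetherian R M :=
    Submodule.IsNoetherian.of_isNoetherian_tensorProduct_of_faithfullyFlat (A := B) inferInstance
  exact Module.IsNoetherian.finite R M

/-! ## Non-zero elements of `A` and the minimal primes of `Â` -/

section Completion

variable {A : Type u} [CommRing A] [IsDomain A] [IsLocalRing A] [IsNoetherianRing A]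

/-- A non-zero element of the domain `A` is a non-zero-divisor of the flat `A`-algebra `Â`.
[cite: StacksProject, Tag 032Y (proof of (4): "As `R → R^∧` is flat …")] -/
theorem algebraMap_adicCompletion_mem_nonZeroDivisors {a : A} (ha : a ≠ 0) :
    algebraMap A (AdicCompletion (maximalIdeal A) A) a ∈
      nonZeroDivisors (AdicCompletion (maximalIdeal A) A) := by
  have hreg : IsSMulRegular (AdicCompletion (maximalIdeal A) A) a :=
    Module.Flat.isSMulRegular_of_nonZeroDivisors (mem_nonZeroDivisors_of_ne_zero ha)
  refine mem_nonZeroDivisors_iff_right.mpr fun x hx => hreg ?_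
  dsimp only
  rw [Algebra.smul_def, smul_zero, mul_comm, hx]

/-- A non-zero element of `A` lies in no minimal prime of `Â` (minimal primes consist of
zero-divisors). [cite: StacksProject, Tag 032Y (proof of (4))] -/
theorem algebraMap_adicCompletion_notMem_of_mem_minimalPrimes
    {𝔮 : Ideal (AdicCompletion (maximalIdeal A) A)}
    (h𝔮 : 𝔮 ∈ minimalPrimes (AdicCompletion (maximalIdeal A) A)) {a : A} (ha : a ≠ 0) :
    algebraMap A (AdicCompletion (maximalIdeal A) A) a ∉ 𝔮 := fun hmem =>
  Set.disjoint_left.mp (Ideal.disjoint_nonZeroDivisors_of_mem_minimalPrimes h𝔮) hmem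
    (algebraMap_adicCompletion_mem_nonZeroDivisors ha)

/-- For a minimal prime `𝔮` of `Â`, the composite `A → Â → Â/𝔮` is injective.
[cite: StacksProject, Tag 032Y (proof of (4))] -/
theorem injective_algebraMap_quotient_of_mem_minimalPrimes
    {𝔮 : Ideal (AdicCompletion (maximalIdeal A) A)}
    (h𝔮 : 𝔮 ∈ minimalPrimes (AdicCompletion (maximalIdeal A) A)) :
    Function.Injective (algebraMap A (AdicCompletion (maximalIdeal A) A ⧸ 𝔮)) := by
  refine (injective_iff_map_eq_zero _).mpr fun a ha => ?_
  by_contra hne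
  rw [IsScalarTower.algebraMap_apply A (AdicCompletion (maximalIdeal A) A) (_ ⧸ 𝔮),
    Ideal.Quotient.algebraMap_eq, Ideal.Quotient.eq_zero_iff_mem] at ha
  exact algebraMap_adicCompletion_notMem_of_mem_minimalPrimes h𝔮 hne ha

/-- An element of `Â` lying in every minimal prime is zero when `Â` is reduced
(`⋂ 𝔮 = nil(Â)`). [cite: StacksProject, Tag 032Y (proof of (4))] -/
theorem eq_zero_of_forall_mem_minimalPrimes {R : Type*} [CommRing R] [IsReduced R] {b : R}
    (hb : ∀ 𝔮 ∈ minimalPrimes R, b ∈ 𝔮) : b = 0 := by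
  have hmem : b ∈ sInf (minimalPrimes R) := Submodule.mem_sInf.mpr hb
  have hrad : sInf (minimalPrimes R) = (⊥ : Ideal R).radical := by
    rw [minimalPrimes, Ideal.sInf_minimalPrimes]
  rw [hrad] at hmem
  obtain ⟨n, hn⟩ := hmem
  exact IsReduced.eq_zero b ⟨n, hn⟩

/-! ## The descent theorem -/

/-- **Stacks 10.162.10 (5) with the Nagata input isolated.** Let `A` be a Noetherian local domain
whose completion `Â` is reduced ("analytically unramified"), and assume that for every minimal prime
`𝔮` of `Â` the integral closure of the complete local domain `Â/𝔮` in its field of fractions is a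
finite `Â/𝔮`-module (which is Stacks 10.162.8 / EGA 0_IV 23.1.5 for these rings). Then the integral
closure of `A` in `Frac A` is a finite `A`-module. Proof as printed: `Â ⊗_A A' ↪ Â ⊗_A Frac A ↪
∏_𝔮 Frac(Â/𝔮)` lands in the finite `Â`-module `∏_𝔮 (Â/𝔮)'`, and faithful flatness descends the
finiteness. [cite: StacksProject, Tag 032Y (Lemma 10.162.10 (4), (5))]
[cite: EGAIV2, (7.6.1) p. 209] -/
theorem module_finite_integralClosure_of_isReduced_adicCompletion_of_minimalPrimes
    (hred : IsReduced (AdicCompletion (maximalIdeal A) A))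
    (hN : ∀ 𝔮 ∈ minimalPrimes (AdicCompletion (maximalIdeal A) A),
      Module.Finite (AdicCompletion (maximalIdeal A) A ⧸ 𝔮)
        (integralClosure (AdicCompletion (maximalIdeal A) A ⧸ 𝔮)
          (FractionRing (AdicCompletion (maximalIdeal A) A ⧸ 𝔮)))) :
    Module.Finite A (integralClosure A (FractionRing A)) := by
  classical
  -- notation
  set Ah := AdicCompletion (maximalIdeal A) A with hAh
  haveI : IsNoetherianRing Ah := isNoetherianRing_adicCompletion_maximalIdeal A
  haveI : Module.FaithfullyFlat A Ah := Module.FaithfullyFlat.of_flat_of_isLocalHom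
  let K := FractionRing A
  let ι : Type u := ↥(minimalPrimes Ah)
  haveI : Finite ι := (minimalPrimes.finite_of_isNoetherianRing Ah).to_subtype
  haveI hprime : ∀ 𝔮 : ι, (𝔮.1).IsPrime := fun 𝔮 => 𝔮.2.1.1
  let D : ι → Type u := fun 𝔮 => Ah ⧸ 𝔮.1
  let F : ι → Type u := fun 𝔮 => FractionRing (D 𝔮)
  let P : Type u := ∀ 𝔮 : ι, F 𝔮
  -- the comparison maps `θ_𝔮 : K → Frac(Â/𝔮)` extending `A → Â → Â/𝔮`
  have hinj : ∀ 𝔮 : ι, Function.Injective (Algebra.ofId A (F 𝔮)) := fun 𝔮 => by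
    change Function.Injective (algebraMap A (F 𝔮))
    rw [IsScalarTower.algebraMap_eq A (D 𝔮) (F 𝔮), RingHom.coe_comp]
    exact (IsFractionRing.injective (D 𝔮) (F 𝔮)).comp
      (injective_algebraMap_quotient_of_mem_minimalPrimes 𝔮.2)
  let θ : ∀ 𝔮 : ι, K →ₐ[A] F 𝔮 := fun 𝔮 => IsFractionRing.liftAlgHom (K := K) (hinj 𝔮)
  let Θ : K →ₐ[A] P := AlgHom.pi θ
  let Ψ₀ : Ah ⊗[A] K →ₐ[Ah] P :=
    Algebra.TensorProduct.lift (Algebra.ofId Ah P) Θ fun x y => Commute.all _ _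
  -- `Â ⊗_A K` is the localisation of `Â` at `A ∖ 0`, and `Ψ₀` is injective since `⋂ 𝔮 = 0`
  have hΨ₀ : Function.Injective Ψ₀ := by
    rw [injective_iff_map_eq_zero]
    intro x hx
    obtain ⟨⟨b, s⟩, hbs⟩ := IsLocalization.mk'_surjective
      (Algebra.algebraMapSubmonoid Ah (nonZeroDivisors A)) x
    simp only at hbs
    subst hbs
    have hb : algebraMap Ah P b = 0 := by
      have h1 : Ψ₀ (algebraMap Ah (Ah ⊗[A] K) b) = algebraMap Ah P b := Ψ₀.commutes b
      rw [← IsLocalization.mk'_spec' (Ah ⊗[A] K) b s, map_mul, hx, mul_zero] at h1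
      exact h1.symm
    have hb0 : b = 0 := by
      refine eq_zero_of_forall_mem_minimalPrimes fun 𝔮 h𝔮 => ?_
      have h2 : algebraMap Ah (F ⟨𝔮, h𝔮⟩) b = 0 := by
        have := congrFun hb ⟨𝔮, h𝔮⟩
        simpa [P] using this
      rw [IsScalarTower.algebraMap_apply Ah (D ⟨𝔮, h𝔮⟩) (F ⟨𝔮, h𝔮⟩),
        map_eq_zero_iff _ (IsFractionRing.injective (D ⟨𝔮, h𝔮⟩) (F ⟨𝔮, h𝔮⟩))] at h2
      exact Ideal.Quotient.eq_zero_iff_mem.mp h2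
    rw [hb0, IsLocalization.mk'_zero]
  -- the integral closures
  let M : Submodule A K := Subalgebra.toSubmodule (integralClosure A K)
  let Cq : ∀ 𝔮 : ι, Submodule Ah (F 𝔮) := fun 𝔮 =>
    (Subalgebra.toSubmodule (integralClosure (D 𝔮) (F 𝔮))).restrictScalars Ah
  let C : Submodule Ah P := Submodule.pi Set.univ Cq
  have hCq : ∀ 𝔮 : ι, (Cq 𝔮).FG := fun 𝔮 => by
    haveI : Module.Finite (D 𝔮) (integralClosure (D 𝔮) (F 𝔮)) := hN 𝔮.1 𝔮.2
    haveI : Module.Finite Ah (integralClosure (D 𝔮) (F 𝔮)) := Module.Finite.trans (D 𝔮) _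
    exact Module.Finite.iff_fg.mp (by exact this)
  have hC : C.FG := Submodule.fg_pi fun 𝔮 => hCq 𝔮
  -- `Θ` maps integral elements to integral elements
  have hΘ : ∀ m : K, m ∈ M → Θ m ∈ C := fun m hm => by
    refine Submodule.mem_pi.mpr fun 𝔮 _ => ?_
    change θ 𝔮 m ∈ integralClosure (D 𝔮) (F 𝔮)
    have hint : IsIntegral A m := hm
    exact (hint.map (θ 𝔮)).tower_top
  -- the comparison map on `Â ⊗ A'`
  let Ψ : Ah ⊗[A] M →ₗ[Ah] P := Ψ₀.toLinearMap ∘ₗ LinearMap.baseChange Ah M.subtype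
  have hΨ : Function.Injective Ψ := by
    refine hΨ₀.comp ?_
    have := Module.Flat.lTensor_preserves_injective_linearMap (M := Ah) M.subtype
      Subtype.val_injective
    rwa [← LinearMap.baseChange_eq_ltensor] at this
  have hle : LinearMap.range Ψ ≤ C := by
    rintro _ ⟨x, rfl⟩
    induction x using TensorProduct.induction_on with
    | zero => simp
    | tmul b m =>
      change Ψ₀ (b ⊗ₜ (m : K)) ∈ C
      rw [Algebra.TensorProduct.lift_tmul]
      change algebraMap Ah P b * Θ m ∈ C
      rw [← Algebra.smul_def]
      exact C.smul_mem b (hΘ m m.2)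
    | add x y hx hy => rw [map_add]; exact C.add_mem hx hy
  exact module_finite_of_faithfullyFlat_of_injective M Ψ hΨ C hC hle

end Completion

end Literature.AlgebraicGeometry.Resolution

end
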